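import Summits.PneNP.PneNP.Theses.LightLogic
import Literature.Computability.ImplicitComplexity.ObsessionalCliques
import Literature.Computability.ImplicitComplexity.CliqueDecides
import Literature.Computability.ImplicitComplexity.ObsessionalCliqueSaturation
import Literature.Computability.ImplicitComplexity.SoftProgramInterpretation

/-!
# `OracleRefusal` (stmt-PneNP-1864, route PneNP/LightLogic) — negative side: the table clique

Crux-attack (refuter, 2026-08-16) on the informal crux `OracleRefusal` ("for the candidate
`Φ⁰_t = obsessional-from-t ∧ Ehrhard-finitary ∧ size-tame` some language `O` is decided by NO total
consistent clique `c ∈ Φ⁰_t`; equivalently the `Φ⁰`-saturation of the graph of `χ_O` leaves `Φ⁰_t` or breaks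
consistency"). Only the first conjunct of `Φ⁰` has a Lean meaning (`URel.ObsessionalFrom`); this file settles
what the typable part says over the landed interface `URel.CliqueDecides` (LTdF = Laurent–Tortora de Falco,
LICS 2006, §5). Nothing here asserts a Theses statement (the item has no Lean declaration yet).

* §1 toolkit (`act_whyNot`, distinct act-invariant labels `lab`, canonical Booleans `cb b ∈ ⟦b⟧ ∖ ⟦¬b⟧`).
* §2 the TABLE CLIQUE `table χ = {(q_w^(k))‾ ⅋ y | k ≥ 1, y ∈ ⟦χ w⟧}`, `q_w^(k) = ?(k • edges w) ⅋ (lab |w| ⅋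
  (lab 0)‾)`, `edges w` = the labelled directed path `lab |w| → ⋯ → lab 0` carrying the letters of `w`
  (`q_w^(1) ∈ ⟦w̄⟧`): `t`-obsessional for EVERY `t`, fixed by the saturation `obsessionalFromHull 0`, and
  deciding `{w | χ w}` with one input copy (a dilated row is the edge multiset of no walk; `eq_of_tablePt_mem`).
* §3 `oracleComplete_plainObsessional`: EVERY language is so decided; the typable-today form
  `∃ O, ∀ t k c, ObsessionalFrom t c → ¬ CliqueDecides k c O` is FALSE (`not_oracleRefusal_plainObsessional`).
  Rows have the `?`-cardinalities (`|w|`, `k|w|`) of genuine word-traversing nets: a size-growth conjunct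
  cannot reject them either.
* §4 the two formulations are NOT equivalent: the full graph `{q‾ ⅋ y | q ∈ ⟦w̄⟧, y ∈ ⟦O w⟧}` is inconsistent
  before any saturation once `O` separates two words of equal length (`not_cliqueDecides_graph`):
  `⟦[tt]̄⟧ ∩ ⟦[ff]̄⟧ ≠ ∅` via the self-dual Boolean point `(a ⅋ a) ⅋ (ā ⊗ ā) ∈ ⟦tt⟧ ∩ ⟦ff⟧`.
* §5 labels MUST be distinct: with constant labels the `2`-dilation of the row of `[tt]` lies in `⟦[tt,tt]̄⟧`
  (`constLabel_dilation_mem`) — correction to refuter REVIEW2's recipe (evidence on stmt-PneNP-1864).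
* §6 `oracleComplete_of_ideal`: for ANY sub-clique- and union-closed `Φ` (every finiteness structure), `Φ` admits
  the tables of the two trivial languages ⇒ `Φ ∧ obsessional` is oracle-complete: the test does not see `O`.
-/

namespace Summit.PneNP.PneNP.Theorems.OracleRefusal.Negative

open Literature.Computability.ImplicitComplexity
open Literature.Computability.ImplicitComplexity.URel

/-! ## §1 Toolkit -/

/-- `(?μ)ₜ⁽ᵏ⁾ = ?(mbump t k (μ acted upon))` (the `?`-twin of `URel.Point.act_ofCourse`).
[cite: LaurentTortoraDeFalco2006, Def. 13] -/
theorem act_whyNot (t k : ℕ) (m : Multiset Point) :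
    Point.act t k (Point.whyNot m) = Point.whyNot (mbump t k (m.map (Point.act t k))) := by
  have hm := Point.coe_map_mk_toList_out m
  have h1 : Point.whyNot m = Point.mk (PrePoint.whyNot ((m.map Quotient.out).toList)) := rfl
  rw [h1]
  generalize (m.map Quotient.out).toList = l at hm ⊢
  subst hm
  rw [Point.act_mk]
  simp only [PrePoint.act]
  rw [PrePoint.actList_eq_map, Point.mk_whyNot, PrePoint.map_bump]
  congr 1
  have hcomp : (Point.act t k ∘ Point.mk) = (Point.mk ∘ PrePoint.act t k) := funext fun _ => rfl
  rw [PrePoint.coe_bump, List.map_map, mbump, Multiset.map_coe, List.map_map, hcomp]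
  simp only [Multiset.coe_card, List.length_map]

/-- `1 ≠ x ⊗ y` in `D`. [cite: LaurentTortoraDeFalco2006, §5.1] -/
theorem one_ne_tensor (p q : Point) : Point.one ≠ Point.tensor p q := by
  induction p using Point.ind with
  | h x => induction q using Point.ind with
    | h y =>
      intro h
      rw [Point.tensor_mk, ← Point.mk_one, Point.mk_eq_mk] at h
      cases PrePoint.one_equiv_iff.1 h

/-- The labels `lab 0 = 1`, `lab (j+1) = 1 ⊗ lab j`: pairwise distinct, exponential-free. [folklore] -/
def lab : ℕ → Point
  | 0 => Point.one
  | j + 1 => Point.tensor Point.one (lab j)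

/-- The labels are pairwise distinct. [folklore] -/
theorem lab_injective : Function.Injective lab := by
  intro i j h
  induction i generalizing j with
  | zero => cases j with
    | zero => rfl
    | succ j => exact absurd h (one_ne_tensor _ _)
  | succ i ih => cases j with
    | zero => exact absurd h.symm (one_ne_tensor _ _)
    | succ j => simp only [lab, Point.tensor_inj, true_and] at h; rw [ih h]

/-- The labels are fixed by every action (they are exponential-free). [cite: LaurentTortoraDeFalco2006, §5.3] -/
@[simp] theorem act_lab (t k j : ℕ) : Point.act t k (lab j) = lab j := by
  induction j with
  | zero => exact Point.act_one' t k
  | succ j ih => simp only [lab, Point.act_tensor, Point.act_one', ih]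

/-- Canonical Boolean points `cb tt = (1 ⅋ ⊥) ⅋ (⊥ ⊗ 1)`, `cb ff = (1 ⅋ ⊥) ⅋ (1 ⊗ ⊥)`.
[cite: LaurentTortoraDeFalco2006, Def. 12] -/
def cb : Bool → Point
  | true => Point.ttPoint Point.one Point.bot
  | false => Point.ffPoint Point.one Point.bot

/-- `cb b ∈ ⟦b⟧`. [cite: LaurentTortoraDeFalco2006, Def. 12] -/
theorem cb_mem (b : Bool) : cb b ∈ boolClique b := by
  cases b
  · exact ⟨Point.one, Point.bot, rfl⟩
  · exact ⟨Point.one, Point.bot, rfl⟩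

/-- `cb b` lies in `⟦b'⟧` only for `b' = b`. [folklore] -/
theorem eq_of_cb_mem {b b' : Bool} (h : cb b ∈ boolClique b') : b = b' := by
  cases b <;> cases b'
  · rfl
  · exact absurd h ffPoint_one_bot_not_mem
  · exact absurd h ttPoint_one_bot_not_mem
  · rfl

/-- The canonical Boolean points are fixed by every action. [cite: LaurentTortoraDeFalco2006, §5.3] -/
@[simp] theorem act_cb (t k : ℕ) (b : Bool) : Point.act t k (cb b) = cb b := by
  cases b <;>
    simp [cb, Point.ttPoint, Point.ffPoint, Point.act_par, Point.act_tensor, Point.dual_one,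
      Point.dual_bot]

/-- `⟦tt⟧` and `⟦ff⟧` are closed under every action. [cite: LaurentTortoraDeFalco2006, Def. 13] -/
theorem act_mem_boolClique {b : Bool} {y : Point} (hy : y ∈ boolClique b) (t k : ℕ) :
    Point.act t k y ∈ boolClique b := by
  cases b <;> obtain ⟨a, c, rfl⟩ := hy <;> exact ⟨a.act t k, c.act t k, by
    simp [Point.ttPoint, Point.ffPoint, Point.act_par, Point.act_tensor, Point.dual_act]⟩

/-! ## §2 The table clique -/

/-- The `i`-th edge `cb b ⊗ ((lab (i+1))‾ ⊗ lab i)` of the labelled path of a word (the `i`-th derelicted step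
function of `⟦w̄⟧` run at labels `lab`, letter at `cb b`). [cite: LaurentTortoraDeFalco2006, Def. 12] -/
def entry (b : Bool) (i : ℕ) : Point :=
  Point.tensor (cb b) (Point.tensor (Point.dual (lab (i + 1))) (lab i))

/-- Edges are fixed by every action. [cite: LaurentTortoraDeFalco2006, §5.3] -/
@[simp] theorem act_entry (t k : ℕ) (b : Bool) (i : ℕ) : Point.act t k (entry b i) = entry b i := by
  simp [entry, Point.act_tensor, ← Point.dual_act]

/-- The edge multiset of the labelled path of `w`. [cite: LaurentTortoraDeFalco2006, Def. 12] -/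
noncomputable def edges (w : List Bool) : Multiset Point :=
  ((List.ofFn fun i : Fin w.length => entry w[i] i : List Point) : Multiset Point)

/-- `edges w` has `|w|` elements. [folklore] -/
@[simp] theorem card_edges (w : List Bool) : Multiset.card (edges w) = w.length := by
  simp [edges]

/-- The edge multiset is fixed pointwise by every action. [cite: LaurentTortoraDeFalco2006, §5.3] -/
@[simp] theorem edges_map_act (t k : ℕ) (w : List Bool) : (edges w).map (Point.act t k) = edges w := by
  unfold edges
  rw [Multiset.map_coe, List.map_ofFn]
  simp only [Function.comp_def, act_entry]

/-- The rows `q_w^(k) = ?(k • edges w) ⅋ (lab |w| ⅋ (lab 0)‾)`: for `k = 1` a result of the experiment of `w̄`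
(`tablePt_one_mem`), for `k ≥ 2` its `k`-dilation. [cite: LaurentTortoraDeFalco2006, Def. 12–13] -/
noncomputable def tablePt (w : List Bool) (k : ℕ) : Point :=
  Point.par (Point.whyNot (k • edges w)) (Point.par (lab w.length) (Point.dual (lab 0)))

/-- The undilated row of `w` is a point of `⟦w̄⟧`. [cite: LaurentTortoraDeFalco2006, Def. 12] -/
theorem tablePt_one_mem (w : List Bool) : tablePt w 1 ∈ wordClique w := by
  refine ⟨fun i => cb w[i], fun j => lab j, fun i => cb_mem _, ?_⟩
  simp only [tablePt, one_nsmul, edges, Point.wordPoint, entry, Fin.val_succ, Fin.val_castSucc,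
    Fin.val_last, Fin.val_zero]

/-- The action on a row is a dilation: `(q_w^(k))ₜ⁽ᵐ⁾` is `q_w^(k)` (if `k|w| ≤ t`) or `q_w^(mk)`.
[cite: LaurentTortoraDeFalco2006, Def. 13] -/
theorem act_tablePt (t m k : ℕ) (w : List Bool) :
    Point.act t m (tablePt w k) = tablePt w k ∨ Point.act t m (tablePt w k) = tablePt w (m * k) := by
  unfold tablePt
  rw [Point.act_par, Point.act_par, act_whyNot, act_lab, ← Point.dual_act, act_lab, Multiset.map_nsmul,
    edges_map_act]
  unfold mbump
  split_ifs
  · exact Or.inl rfl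
  · exact Or.inr (by rw [smul_smul])

/-- **The table clique** of a Boolean-valued function on words: all points `(q_w^(k))‾ ⅋ y` with `k ≥ 1` and
`y ∈ ⟦χ w⟧`. [folklore] -/
def table (χ : List Bool → Bool) : Set Point :=
  {z | ∃ (w : List Bool) (k : ℕ) (y : Point), 0 < k ∧ y ∈ boolClique (χ w) ∧
    z = Point.par (Point.dual (tablePt w k)) y}

/-- The table clique is `t`-obsessional for EVERY `t` (in particular obsessional from `0`).
[cite: LaurentTortoraDeFalco2006, Def. 13] -/
theorem isObsessional_table (χ : List Bool → Bool) (t : ℕ) : IsObsessional t (table χ) := by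
  rintro _ ⟨w, k, y, hk, hy, rfl⟩ m hm
  rw [Point.act_par, ← Point.dual_act]
  rcases act_tablePt t m k w with h | h
  · exact ⟨w, k, _, hk, act_mem_boolClique hy t m, by rw [h]⟩
  · exact ⟨w, m * k, _, Nat.mul_pos hm hk, act_mem_boolClique hy t m, by rw [h]⟩

/-- The table clique is obsessional from every threshold. [cite: LaurentTortoraDeFalco2006, Def. 13] -/
theorem obsessionalFrom_table (χ : List Bool → Bool) (t : ℕ) : ObsessionalFrom t (table χ) :=
  fun t' _ => isObsessional_table χ t'

/-- **Key lemma (rows are unambiguous).** A row `q_{w'}^(k)`, `k ≥ 1`, lies in `⟦w̄⟧` only if `w' = w`: the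
labels of a point of `⟦w̄⟧` form a walk ending at `lab 0`, every edge of `k • edges w'` goes `lab (j+1) → lab j`,
so the walk is forced (induction), `|w| ≤ |w'| ≤ k|w'| = |w|`, and `cb` separates the letters. [folklore] -/
theorem eq_of_tablePt_mem {w w' : List Bool} {k : ℕ} (hk : 0 < k) (h : tablePt w' k ∈ wordClique w) :
    w' = w := by
  obtain ⟨β, p, hβ, he⟩ := h
  unfold tablePt Point.wordPoint at he
  simp only [Point.par_inj] at he
  obtain ⟨hM, -, h0⟩ := he
  have hM' := Point.whyNot_injective hM
  have h0' : p 0 = lab 0 := by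
    have := congrArg Point.dual h0
    rwa [Point.dual_dual, Point.dual_dual, eq_comm] at this
  have hmem : ∀ i : Fin w.length, ∃ j : Fin w'.length,
      β i = cb w'[j] ∧ p i.succ = lab (j + 1) ∧ p i.castSucc = lab j := by
    intro i
    have hi : Point.tensor (β i) (Point.tensor (Point.dual (p i.succ)) (p i.castSucc)) ∈ k • edges w' := by
      rw [hM', Multiset.mem_coe, List.mem_ofFn]
      exact ⟨i, rfl⟩
    obtain ⟨-, hi⟩ := Multiset.mem_nsmul.1 hi
    rw [edges, Multiset.mem_coe, List.mem_ofFn] at hi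
    obtain ⟨j, hj⟩ := hi
    simp only [entry, Point.tensor_inj] at hj
    obtain ⟨h1, h2, h3⟩ := hj
    refine ⟨j, h1.symm, ?_, h3.symm⟩
    have := congrArg Point.dual h2
    rw [Point.dual_dual, Point.dual_dual] at this
    exact this.symm
  have hp : ∀ i : Fin (w.length + 1), p i = lab i := by
    intro i
    induction i using Fin.induction with
    | zero => simpa using h0'
    | succ i ih =>
      obtain ⟨j, -, h2, h3⟩ := hmem i
      rw [ih, Fin.val_castSucc] at h3
      have hij : (i : ℕ) = j := lab_injective h3
      rw [h2, Fin.val_succ, hij]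
  have hle : w.length ≤ w'.length := by
    by_contra hlt
    rw [not_le] at hlt
    obtain ⟨j, -, -, h3⟩ := hmem ⟨w'.length, hlt⟩
    rw [hp, Fin.val_castSucc] at h3
    have h3' : w'.length = (j : ℕ) := lab_injective h3
    exact absurd j.isLt (by omega)
  have hcard : k * w'.length = w.length := by
    have := congrArg Multiset.card hM'
    simpa [Multiset.card_nsmul] using this
  have hlen : w'.length = w.length := by
    apply le_antisymm _ hle
    calc w'.length ≤ k * w'.length := Nat.le_mul_of_pos_left _ hk
      _ = w.length := hcard
  apply List.ext_getElem hlen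
  intro i h1 h2
  obtain ⟨j, hb, -, h3⟩ := hmem ⟨i, h2⟩
  rw [hp, Fin.val_castSucc] at h3
  have hij : i = (j : ℕ) := lab_injective h3
  have hmem' : cb w'[j] ∈ boolClique w[(⟨i, h2⟩ : Fin w.length)] := hb ▸ hβ ⟨i, h2⟩
  have := eq_of_cb_mem hmem'
  simp only [Fin.getElem_fin] at this
  subst hij
  exact this

/-- The table answers `⟦χ w⟧` on `⟦w̄⟧`, exactly. [folklore] -/
theorem feed_table (χ : List Bool → Bool) (w : List Bool) :
    feed 1 (table χ) (wordClique w) = boolClique (χ w) := by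
  ext y
  rw [mem_feed_one]
  constructor
  · rintro ⟨x, ⟨w', k, y', hk, hy', he⟩, hxw⟩
    rw [Point.par_inj] at he
    obtain ⟨rfl, rfl⟩ := he
    rw [Point.dual_dual] at hxw
    rwa [eq_of_tablePt_mem hk hxw] at hy'
  · intro hy
    exact ⟨Point.dual (tablePt w 1), ⟨w, 1, y, Nat.one_pos, hy, rfl⟩, by
      rw [Point.dual_dual]; exact tablePt_one_mem w⟩

/-- **The table clique decides `{w | χ w}` with one input copy.** [folklore] -/
theorem cliqueDecides_table (χ : List Bool → Bool) :
    CliqueDecides 1 (table χ) ({w | χ w = true} : Set (List Bool)) := by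
  intro w
  refine ⟨fun hw => ?_, fun hw => ?_⟩
  · change χ w = true at hw
    rw [feed_table, hw]
  · change ¬ χ w = true at hw
    rw [feed_table, eq_false_of_ne_true hw]

/-- In the item's own words, for the TABLE reading of "the graph of `χ_O`": its `Φ`-saturation
(`URel.obsessionalFromHull 0`) neither leaves plain obsessionality nor breaks consistency. [folklore] -/
theorem cliqueDecides_saturation_table (χ : List Bool → Bool) :
    CliqueDecides 1 (obsessionalFromHull 0 (table χ)) ({w | χ w = true} : Set (List Bool)) := by
  rw [(obsessionalFrom_table χ 0).obsessionalFromHull_eq]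
  exact cliqueDecides_table χ

/-! ## §3 Consequences for the crux -/

open Classical in
/-- The characteristic function of a language (classical). [folklore] -/
noncomputable def chi (O : Language Bool) (w : List Bool) : Bool := decide (w ∈ O)

/-- `{w | chi O w} = O`. [folklore] -/
theorem setOf_chi (O : Language Bool) : ({w | chi O w = true} : Set (List Bool)) = O :=
  Language.ext fun w => by
    show chi O w = true ↔ w ∈ O
    unfold chi
    simp only [decide_eq_true_eq]

/-- **Plain obsessionality is oracle-complete at the `CliqueDecides` interface**: EVERY language — recursive
or not — is decided, with one input copy, by a clique `t`-obsessional for every `t`. [folklore] -/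
theorem oracleComplete_plainObsessional (O : Language Bool) :
    ∃ c : Set Point, (∀ t, IsObsessional t c) ∧ CliqueDecides 1 c O := by
  refine ⟨table (chi O), isObsessional_table _, ?_⟩
  have := cliqueDecides_table (chi O)
  rwa [setOf_chi] at this

/-- **The typable-today form of `OracleRefusal` is false**: with `Φ⁰_t :=` "obsessional from `t`" NO language
is refused at every level — not even at level `0` with a single input copy. [folklore] -/
theorem not_oracleRefusal_plainObsessional :
    ¬ ∃ O : Language Bool, ∀ (t k : ℕ) (c : Set Point), ObsessionalFrom t c → ¬ CliqueDecides k c O := by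
  rintro ⟨O, hO⟩
  obtain ⟨c, hc, hd⟩ := oracleComplete_plainObsessional O
  exact hO 0 1 c (fun t _ => hc t) hd

/-- Variant over `t`-obsessionality level by level (the `IsObsessional` reading of "`c ∈ Φ⁰_t`"). [folklore] -/
theorem not_oracleRefusal_isObsessional :
    ¬ ∃ O : Language Bool, ∀ (t k : ℕ) (c : Set Point), IsObsessional t c → ¬ CliqueDecides k c O := by
  rintro ⟨O, hO⟩
  obtain ⟨c, hc, hd⟩ := oracleComplete_plainObsessional O
  exact hO 0 1 c (hc 0) hd

/-! ## §4 The "equivalently" clause: the full graph of `χ_O` is inconsistent before any saturation -/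

/-- The self-dual Boolean point `(a ⅋ a) ⅋ (ā ⊗ ā)` of `⟦tt⟧` lies in `⟦ff⟧` too (`REL` is not complete).
[cite: LaurentTortoraDeFalco2006, §5.3] -/
theorem ttPoint_self_mem_false (a : Point) : Point.ttPoint a a ∈ boolClique false := ⟨a, a, rfl⟩

/-- Hence two words of the same length have intersecting interpretations: run every letter at a
self-dual Boolean point (and all `X`-labels at `1`). [cite: LaurentTortoraDeFalco2006, §5.3] -/
theorem wordClique_inter_nonempty {w w' : List Bool} (h : w.length = w'.length) :
    (wordClique w ∩ wordClique w').Nonempty := by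
  have hb : ∀ b : Bool, Point.ttPoint Point.one Point.one ∈ boolClique b := by
    rintro (_ | _)
    · exact ttPoint_self_mem_false _
    · exact ⟨_, _, rfl⟩
  refine ⟨Point.wordPoint w.length (fun _ => Point.ttPoint Point.one Point.one) (fun _ => Point.one),
    ⟨_, _, fun i => hb _, rfl⟩, fun _ => Point.ttPoint Point.one Point.one, fun _ => Point.one,
    fun i => hb _, ?_⟩
  rw [h]

/-- The FULL graph of `χ_O`: every point of every `⟦w̄⟧`, dualised, paired with every point of `⟦O w⟧` (the
clique the item proposes to saturate). [folklore] -/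
def graph (O : Language Bool) : Set Point :=
  {z | ∃ (w : List Bool) (q y : Point), q ∈ wordClique w ∧
    ((w ∈ O ∧ y ∈ boolClique true) ∨ (w ∉ O ∧ y ∈ boolClique false)) ∧ z = Point.par (Point.dual q) y}

/-- **The full graph does not decide `O`** once `O` separates two words of the same length — before any
saturation, for a reason unrelated to `Φ⁰`: the shared point of `⟦w̄⟧ ∩ ⟦w̄'⟧` receives both answers. So the
item's second formulation holds for every such `O` and is NOT equivalent to the first (refuted in §3 for plain
obsessionality by a SUB-clique of the same graph). [folklore] -/
theorem not_cliqueDecides_graph {O : Language Bool} {w w' : List Bool} (hlen : w.length = w'.length)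
    (hw : w ∈ O) (hw' : w' ∉ O) : ¬ CliqueDecides 1 (graph O) O := by
  intro hdec
  obtain ⟨q, hq, hq'⟩ := wordClique_inter_nonempty hlen
  have hmem : cb false ∈ feed 1 (graph O) (wordClique w) :=
    mem_feed_one.2 ⟨Point.dual q, ⟨w', q, cb false, hq', Or.inr ⟨hw', cb_mem false⟩, rfl⟩,
      by rw [Point.dual_dual]; exact hq⟩
  rw [(hdec w).1 hw] at hmem
  exact absurd (eq_of_cb_mem hmem) (by decide)

/-! ## §5 Why the labels must be distinct (correction to the REVIEW2 recipe) -/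

/-- With CONSTANT labels (all `X`-axioms at `1`) the `2`-dilation (level `0`) of the row of `[tt]` is a point
of `⟦[tt, tt]̄⟧` (a doubled loop is again a walk): the distinct labels `lab` of §2 are essential. [folklore] -/
theorem constLabel_dilation_mem :
    Point.act 0 2 (Point.wordPoint 1 (fun _ => cb true) (fun _ => Point.one)) ∈
      wordClique [true, true] := by
  have hall : ∀ i : Fin [true, true].length, [true, true][i] = true := by decide
  refine ⟨fun _ => cb true, fun _ => Point.one, fun i => by rw [hall]; exact cb_mem true, ?_⟩
  have hae : Point.act 0 2 (Point.tensor (cb true) (Point.tensor (Point.dual Point.one) Point.one)) =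
      Point.tensor (cb true) (Point.tensor (Point.dual Point.one) Point.one) := by
    rw [Point.act_tensor, act_cb, Point.act_tensor, ← Point.dual_act, Point.act_one']
  simp only [Point.wordPoint, List.ofFn_succ, List.ofFn_zero, Point.act_par, act_whyNot, Point.act_one',
    ← Point.dual_act, Multiset.map_coe, List.map_cons, List.map_nil, hae]
  rw [mbump_of_lt (by simp), two_nsmul, Multiset.coe_add]
  rfl

/-! ## §6 Ideal dichotomy: what any finiteness-type conjunct can and cannot do -/

/-- Every table lies in the union of the tables of the two CONSTANT (trivial) languages. [folklore] -/
theorem table_subset_union (χ : List Bool → Bool) :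
    table χ ⊆ table (fun _ => true) ∪ table (fun _ => false) := by
  rintro _ ⟨w, k, y, hk, hy, rfl⟩
  cases h : χ w
  · rw [h] at hy; exact Or.inr ⟨w, k, y, hk, hy, rfl⟩
  · rw [h] at hy; exact Or.inl ⟨w, k, y, hk, hy, rfl⟩

/-- **Ideal dichotomy.** Let `Φ` be ANY property of cliques closed under sub-cliques and binary unions — every
Ehrhard finiteness structure `F = G^⊥` is one, whatever web and orthogonal `G` are chosen on `D`. If `Φ` admits the
tables of the two trivial languages `{0,1}*` and `∅`, then "`Φ ∧` obsessional for every `t`" decides EVERY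
language. So for such a `Φ` the admission test `OracleRefusal` has ONE cheapest falsifier, the membership
`table tt ∪ table ff ∈ Φ`, in which the complexity of `O` plays no role; and a `Φ` refusing some oracle must
refuse a table of a TRIVIAL language. [folklore] -/
theorem oracleComplete_of_ideal (Φ : Set Point → Prop) (hsub : ∀ c d, d ⊆ c → Φ c → Φ d)
    (hun : ∀ c d, Φ c → Φ d → Φ (c ∪ d)) (htt : Φ (table fun _ => true)) (hff : Φ (table fun _ => false))
    (O : Language Bool) : ∃ c : Set Point, Φ c ∧ (∀ t, IsObsessional t c) ∧ CliqueDecides 1 c O := by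
  refine ⟨table (chi O), hsub _ _ (table_subset_union _) (hun _ _ htt hff), isObsessional_table _, ?_⟩
  have := cliqueDecides_table (chi O)
  rwa [setOf_chi] at this

end Summit.PneNP.PneNP.Theorems.OracleRefusal.Negative
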